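import Summits.QuantumFields.YangMills.Theorems.BalabanUVNodesN08TwoLevelInvisibleFirings
import Summits.QuantumFields.YangMills.Theorems.BalabanUVNodesN08LaunderingLocal
import Summits.QuantumFields.YangMills.Theorems.UV3ReadSetFactorisation

/-!
# BalabanUVNodes ∕ N08 — DELETION OF A FINISHED FIRING: among separated same-level firings, one firing `c` whose weight and value read only its guard's read set can be DELETED two
# levels up at the cost of its mass — `law₁ = (∫ g_c) • law₂` — where `law₁` is the level-`(k+2)` law with the firing at `c` and `law₂` the one without (the other firings kept), both
# presented in the split coordinates (bonds AWAY from `c`'s star, bonds NEAR it)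

Track A, DAG node N08 ([Balaban1985UV3] Thm 1 p. 257 ∕ Thm 2 p. 272; averaging [Balaban1987RG1] (0.4) p. 253).  Cell `pub-ymgap`, seat `pub-ymgap-dag-n08-d` g47 (R529-ym job;
DESIGN memo (M5): the deletion step of the cross-level polymer expansion); ledger key `--supports stmt-QuantumFields-27364 --as helper` («cc 19936 (O‴χₛ) supply», director №326).  Inputs: ✓`…N08LaunderingLocal`
(local Weil core with spectators), px8 ✓p758675 `UV3ReadSetFactorisation` (read-set Tonelli), ✓`…N08TwoLevelInvisibleFiring(s)` (end-bond translations vs read sets).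

CONTENTS ([folklore] over the tree's objects; 0 `def`, 0 `sorry`): §1 translation lemmas for the piecewise hybrid step with a finite firing set `S` (`piecewise_mulLast_eq`,
`piecewise_mulFirst_eq`, `axialAvg_piecewise_mulLast_eq`, `axialAvg_piecewise_mulFirst_eq`); §2 ★ `map_withDensity_mul_eq_smul_of_readSets` (read-set Tonelli with a far-side weight, push-forward
form, from px8's lintegral form), ★★★ `map_pair_eq_smul_of_delete` — THE DELETION IDENTITY.
HONEST: count-neutral helper — same-level deletion of ONE finished firing, separation displayed; clusters across levels ∕ KP (M6) not here; hTop ∕ hJ NOT proved; N08 NOT discharged; R3 ≠ Clay.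
-/

noncomputable section

open MeasureTheory
open scoped ENNReal

namespace Summit.QuantumFields.YangMills.Theorems.BalabanUVNodesN08DeleteFiring

open Literature.MathematicalPhysics.QuantumFieldTheory.Balaban1983to89
open Literature.MathematicalPhysics.QuantumFieldTheory.Balaban1983to89.T4Continuum
open Literature.MathematicalPhysics.QuantumFieldTheory.Balaban1983to89.AveragingRT
open Literature.MathematicalPhysics.QuantumFieldTheory.Balaban1983to89.BlockAveraging
open Summit.QuantumFields.YangMills.Theorems.BalabanUVNodesN08AxialLaunderingFirstBond (first_injective axialAvg_mul_first)
open Summit.QuantumFields.YangMills.Theorems.BalabanUVNodesN08TwoLevelInvisibleFiring (extend_last_apply_eq_one_of_read extend_first_apply_eq_one_of_read)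

variable {P : Params} {k : ℕ} {G : Type*} [GaugeGroup G]

/-- Right-multiplying the LAST fine bonds by the last-bond extension of a coarse field `h′` that is `1` at every bond whose target is an endpoint of a fired bond multiplies the
piecewise hybrid field on the right by `h′` (fired values unchanged: they do not read the translated bonds). [folklore] -/
theorem piecewise_mulLast_eq [DecidableEq (PBond P (k + 1))] (hk : k + 1 ≤ P.m + P.K) (S : Finset (PBond P (k + 1)))
    {m : PBond P (k + 1) → GaugeField P k G → G}
    (hm_read : ∀ c ∈ S, ∀ U U' : GaugeField P k G,
      (∀ (i : Idx P), ∀ s ∈ walk (emb c.src) (loopWord P.L c.dir (off i.1) i.2.1 i.2.2), U s.bond = U' s.bond) → m c U = m c U')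
    (h' : GaugeField P (k + 1) G) (hh' : ∀ c ∈ S, ∀ c₁ : PBond P (k + 1), (c₁.tgt = c.src ∨ c₁.tgt = c.tgt) → h' c₁ = 1) (U : GaugeField P k G) :
    (fun c' : PBond P (k + 1) => if c' ∈ S then m c' (fun b => U b * Function.extend (fun c₁ : PBond P (k + 1) => line c₁ (P.L - 1)) h' (fun _ => 1) b)
        else axialAvg (fun b => U b * Function.extend (fun c₁ : PBond P (k + 1) => line c₁ (P.L - 1)) h' (fun _ => 1) b) c')
      = fun c' => (if c' ∈ S then m c' U else axialAvg U c') * h' c' := by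
  funext c'
  rw [axialAvg_mul_last hk]
  by_cases hc : c' ∈ S
  · rw [if_pos hc, if_pos hc, hm_read c' hc _ U fun i s hs => by rw [extend_last_apply_eq_one_of_read hk c' h' (hh' c' hc) i s hs, mul_one],
      hh' c' hc c' (Or.inr rfl), mul_one]
  · rw [if_neg hc, if_neg hc]

/-- Left twin with FIRST bonds and sources. [folklore] -/
theorem piecewise_mulFirst_eq [DecidableEq (PBond P (k + 1))] (hk : k + 1 ≤ P.m + P.K) (S : Finset (PBond P (k + 1)))
    {m : PBond P (k + 1) → GaugeField P k G → G}
    (hm_read : ∀ c ∈ S, ∀ U U' : GaugeField P k G,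
      (∀ (i : Idx P), ∀ s ∈ walk (emb c.src) (loopWord P.L c.dir (off i.1) i.2.1 i.2.2), U s.bond = U' s.bond) → m c U = m c U')
    (h' : GaugeField P (k + 1) G) (hh' : ∀ c ∈ S, ∀ c₁ : PBond P (k + 1), (c₁.src = c.src ∨ c₁.src = c.tgt) → h' c₁ = 1) (U : GaugeField P k G) :
    (fun c' : PBond P (k + 1) => if c' ∈ S then m c' (fun b => Function.extend (fun c₁ : PBond P (k + 1) => line c₁ 0) h' (fun _ => 1) b * U b)
        else axialAvg (fun b => Function.extend (fun c₁ : PBond P (k + 1) => line c₁ 0) h' (fun _ => 1) b * U b) c')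
      = fun c' => h' c' * (if c' ∈ S then m c' U else axialAvg U c') := by
  funext c'
  rw [axialAvg_mul_first hk]
  by_cases hc : c' ∈ S
  · rw [if_pos hc, if_pos hc, hm_read c' hc _ U fun i s hs => by rw [extend_first_apply_eq_one_of_read hk c' h' (hh' c' hc) i s hs, one_mul],
      hh' c' hc c' (Or.inl rfl), one_mul]
  · rw [if_neg hc, if_neg hc]

/-- ★ Two levels: right-multiplying the last fine bond of the last slot of every `C` by `h C`, for a level-`(k+2)` field `h` that is `1` at every `C` whose last slot's target is an endpoint
of a fired bond, multiplies the level-`(k+2)` push-forward on the right by `h`. [folklore] -/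
theorem axialAvg_piecewise_mulLast_eq [DecidableEq (PBond P (k + 1))] (hk : k + 1 ≤ P.m + P.K) (hk1 : k + 1 + 1 ≤ P.m + P.K) (S : Finset (PBond P (k + 1)))
    {m : PBond P (k + 1) → GaugeField P k G → G}
    (hm_read : ∀ c ∈ S, ∀ U U' : GaugeField P k G,
      (∀ (i : Idx P), ∀ s ∈ walk (emb c.src) (loopWord P.L c.dir (off i.1) i.2.1 i.2.2), U s.bond = U' s.bond) → m c U = m c U')
    (h : GaugeField P (k + 1 + 1) G)
    (hh : ∀ C : PBond P (k + 1 + 1), (∃ c ∈ S, (line C (P.L - 1)).tgt = c.src ∨ (line C (P.L - 1)).tgt = c.tgt) → h C = 1) (U : GaugeField P k G) :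
    (axialAvg (fun c' : PBond P (k + 1) => if c' ∈ S then
        m c' (fun b => U b * Function.extend (fun c₁ : PBond P (k + 1) => line c₁ (P.L - 1))
          (Function.extend (fun C : PBond P (k + 1 + 1) => line C (P.L - 1)) h (fun _ => 1)) (fun _ => 1) b)
        else axialAvg (fun b => U b * Function.extend (fun c₁ : PBond P (k + 1) => line c₁ (P.L - 1))
          (Function.extend (fun C : PBond P (k + 1 + 1) => line C (P.L - 1)) h (fun _ => 1)) (fun _ => 1) b) c') : GaugeField P (k + 1 + 1) G)
      = fun C => axialAvg (fun c' : PBond P (k + 1) => if c' ∈ S then m c' U else axialAvg U c') C * h C := by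
  have hh' : ∀ c ∈ S, ∀ c₁ : PBond P (k + 1), (c₁.tgt = c.src ∨ c₁.tgt = c.tgt) →
      Function.extend (fun C : PBond P (k + 1 + 1) => line C (P.L - 1)) h (fun _ => 1) c₁ = 1 := by
    intro c hcS c₁ hinc
    by_cases hex : ∃ C : PBond P (k + 1 + 1), line C (P.L - 1) = c₁
    · obtain ⟨C, rfl⟩ := hex
      rw [(last_injective hk1).extend_apply]; exact hh C ⟨c, hcS, hinc⟩
    · rw [Function.extend_apply' _ _ _ hex]
  rw [piecewise_mulLast_eq hk S hm_read _ hh' U, axialAvg_mul_last hk1]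

/-- ★ First-bond ∕ left twin of `axialAvg_piecewise_mulLast_eq`. [folklore] -/
theorem axialAvg_piecewise_mulFirst_eq [DecidableEq (PBond P (k + 1))] (hk : k + 1 ≤ P.m + P.K) (hk1 : k + 1 + 1 ≤ P.m + P.K) (S : Finset (PBond P (k + 1)))
    {m : PBond P (k + 1) → GaugeField P k G → G}
    (hm_read : ∀ c ∈ S, ∀ U U' : GaugeField P k G,
      (∀ (i : Idx P), ∀ s ∈ walk (emb c.src) (loopWord P.L c.dir (off i.1) i.2.1 i.2.2), U s.bond = U' s.bond) → m c U = m c U')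
    (h : GaugeField P (k + 1 + 1) G)
    (hh : ∀ C : PBond P (k + 1 + 1), (∃ c ∈ S, (line C 0).src = c.src ∨ (line C 0).src = c.tgt) → h C = 1) (U : GaugeField P k G) :
    (axialAvg (fun c' : PBond P (k + 1) => if c' ∈ S then
        m c' (fun b => Function.extend (fun c₁ : PBond P (k + 1) => line c₁ 0)
          (Function.extend (fun C : PBond P (k + 1 + 1) => line C 0) h (fun _ => 1)) (fun _ => 1) b * U b)
        else axialAvg (fun b => Function.extend (fun c₁ : PBond P (k + 1) => line c₁ 0)
          (Function.extend (fun C : PBond P (k + 1 + 1) => line C 0) h (fun _ => 1)) (fun _ => 1) b * U b) c') : GaugeField P (k + 1 + 1) G)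
      = fun C => h C * axialAvg (fun c' : PBond P (k + 1) => if c' ∈ S then m c' U else axialAvg U c') C := by
  have hh' : ∀ c ∈ S, ∀ c₁ : PBond P (k + 1), (c₁.src = c.src ∨ c₁.src = c.tgt) →
      Function.extend (fun C : PBond P (k + 1 + 1) => line C 0) h (fun _ => 1) c₁ = 1 := by
    intro c hcS c₁ hinc
    by_cases hex : ∃ C : PBond P (k + 1 + 1), line C 0 = c₁
    · obtain ⟨C, rfl⟩ := hex
      rw [(first_injective hk1).extend_apply]; exact hh C ⟨c, hcS, hinc⟩
    · rw [Function.extend_apply' _ _ _ hex]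
  rw [piecewise_mulFirst_eq hk S hm_read _ hh' U, axialAvg_mul_first hk1]

section Delete

variable [MeasurableSpace G] [HaarData G] [MeasurableMul₂ G] [MeasurableInv G]

open Summit.QuantumFields.YangMills.Theorems.BalabanUVNodesN08LaunderingLocal (map_prod_eq_prod_pi_of_translations)
open Summit.QuantumFields.YangMills.Theorems.UV3ReadSetFactorisation (lintegral_mul_eq_mul_of_readSets)

omit [MeasurableMul₂ G] [MeasurableInv G] in
/-- ★ **Read-set Tonelli with a far-side weight, push-forward form** (from px8 ✓p758675 `lintegral_mul_eq_mul_of_readSets`): `f` reads only `S`; the weight `h` and the map `φ`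
read only `Sᶜ` ⇒ `(dU.withDensity (f·h)).map φ = (∫⁻ f dU) • (dU.withDensity h).map φ`. [cite: Balaban1985Averaging, (10) p.19] -/
theorem map_withDensity_mul_eq_smul_of_readSets {Y : Type*} [MeasurableSpace Y] (S : Set (PBond P k))
    {f : GaugeField P k G → ℝ≥0∞} (hf : Measurable f) (hfS : ∀ U U' : GaugeField P k G, (∀ b ∈ S, U b = U' b) → f U = f U')
    {h : GaugeField P k G → ℝ≥0∞} (hh : Measurable h) (hhS : ∀ U U' : GaugeField P k G, (∀ b ∉ S, U b = U' b) → h U = h U')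
    {φ : GaugeField P k G → Y} (hφ : Measurable φ) (hφS : ∀ U U' : GaugeField P k G, (∀ b ∉ S, U b = U' b) → φ U = φ U') :
    ((fieldMeasure P k G).withDensity (fun U => f U * h U)).map φ = (∫⁻ U, f U ∂(fieldMeasure P k G)) • ((fieldMeasure P k G).withDensity h).map φ := by
  ext B hB
  have hind : Measurable (fun U => h U * (φ ⁻¹' B).indicator (1 : GaugeField P k G → ℝ≥0∞) U) := hh.mul (measurable_one.indicator (hφ hB))
  have hindS : ∀ U U' : GaugeField P k G, (∀ b ∉ S, U b = U' b) →
      h U * (φ ⁻¹' B).indicator (1 : GaugeField P k G → ℝ≥0∞) U = h U' * (φ ⁻¹' B).indicator 1 U' := by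
    intro U U' hUU'
    have hφU : φ U = φ U' := hφS U U' hUU'
    rw [hhS U U' hUU']
    by_cases hU : U ∈ φ ⁻¹' B
    · have hU' : U' ∈ φ ⁻¹' B := by rwa [Set.mem_preimage, ← hφU]
      rw [Set.indicator_of_mem hU, Set.indicator_of_mem hU', Pi.one_apply, Pi.one_apply]
    · have hU' : U' ∉ φ ⁻¹' B := by rwa [Set.mem_preimage, ← hφU]
      rw [Set.indicator_of_notMem hU, Set.indicator_of_notMem hU']
  have key := lintegral_mul_eq_mul_of_readSets S hf hind hfS hindS
  rw [Measure.map_apply hφ hB, withDensity_apply _ (hφ hB), Measure.smul_apply, Measure.map_apply hφ hB, withDensity_apply _ (hφ hB), smul_eq_mul,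
    ← lintegral_indicator (hφ hB), ← lintegral_indicator (hφ hB)]
  have h1 : (fun U => (φ ⁻¹' B).indicator (fun U => f U * h U) U) = fun U => f U * (h U * (φ ⁻¹' B).indicator (1 : GaugeField P k G → ℝ≥0∞) U) := by
    funext U
    by_cases hU : U ∈ φ ⁻¹' B
    · rw [Set.indicator_of_mem hU, Set.indicator_of_mem hU, Pi.one_apply, mul_one]
    · rw [Set.indicator_of_notMem hU, Set.indicator_of_notMem hU, mul_zero, mul_zero]
  have h2 : (fun U => (φ ⁻¹' B).indicator h U) = fun U => h U * (φ ⁻¹' B).indicator (1 : GaugeField P k G → ℝ≥0∞) U := by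
    funext U
    by_cases hU : U ∈ φ ⁻¹' B
    · rw [Set.indicator_of_mem hU, Set.indicator_of_mem hU, Pi.one_apply, mul_one]
    · rw [Set.indicator_of_notMem hU, Set.indicator_of_notMem hU, mul_zero]
  rw [h1, h2, key]

/-- ★★★ **DELETION OF A FINISHED FIRING.**  Level-`k` fields; fired bonds `insert c S′` (system 1) resp. `S′` (system 2; `c ∉ S′` follows from `hsepA`), values `m c′` measurable reading only the loop words of
`c′`, weight `g_c` of the firing at `c` reading only the loop words of `c`, weight `g′` of the others reading only theirs (`∫ g_c·g′`, `∫ g′ < ∞`).  SEPARATION: every `c′ ∈ S′` is NOT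
incident to the endpoints of `c` (`hsepA`), and touches neither end-block centre of any level-`(k+2)` bond `C` NEAR `c` (`hsepB`; NEAR = some slot of `C` incident to `c`'s endpoints).
THEN, presenting the level-`(k+2)` field in the split coordinates (bonds away from `c` ∣ bonds near `c`):
`((dU_k)·(g_c g′)).map (Φ₁ away, Φ₁ near) = (∫⁻ g_c dU_k) • ((dU_k)·g′).map (Φ₂ away, Φ₂ near)` — the finished firing is DELETED at the cost of its mass.  Route: near
coordinates laundered in BOTH systems by the local Weil core (✓`map_prod_eq_prod_pi_of_translations`; end-bond translations fix `g_c` by ✓125′'s torus lemma, fix `g′`, `m` by the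
separation, fix the away-coordinates identically); away-coordinates agree pointwise and do not read `c`'s read set, so `g_c` integrates out (read-set Fubini). [cite: Balaban1987RG1, (0.4) p.253] -/
theorem map_pair_eq_smul_of_delete [DecidableEq (PBond P (k + 1))] (hk : k + 1 ≤ P.m + P.K) (hk1 : k + 1 + 1 ≤ P.m + P.K)
    (c : PBond P (k + 1)) (S' : Finset (PBond P (k + 1)))
    {m : PBond P (k + 1) → GaugeField P k G → G} (hm : ∀ c' ∈ insert c S', Measurable (m c'))
    (hm_read : ∀ c' ∈ insert c S', ∀ U U' : GaugeField P k G,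
      (∀ (i : Idx P), ∀ s ∈ walk (emb c'.src) (loopWord P.L c'.dir (off i.1) i.2.1 i.2.2), U s.bond = U' s.bond) → m c' U = m c' U')
    {gc : GaugeField P k G → ℝ≥0∞} (hgc : Measurable gc)
    (hgc_read : ∀ U U' : GaugeField P k G,
      (∀ (i : Idx P), ∀ s ∈ walk (emb c.src) (loopWord P.L c.dir (off i.1) i.2.1 i.2.2), U s.bond = U' s.bond) → gc U = gc U')
    {g' : GaugeField P k G → ℝ≥0∞} (hg' : Measurable g')
    (hg'_read : ∀ U U' : GaugeField P k G,
      (∀ c' ∈ S', ∀ (i : Idx P), ∀ s ∈ walk (emb c'.src) (loopWord P.L c'.dir (off i.1) i.2.1 i.2.2), U s.bond = U' s.bond) → g' U = g' U')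
    (hfin1 : ∫⁻ U, gc U * g' U ∂(fieldMeasure P k G) ≠ ∞) (hfin2 : ∫⁻ U, g' U ∂(fieldMeasure P k G) ≠ ∞)
    (hsepA : ∀ c' ∈ S', (c'.src ≠ c.src ∧ c'.src ≠ c.tgt) ∧ (c'.tgt ≠ c.src ∧ c'.tgt ≠ c.tgt))
    (A : Set (PBond P (k + 1 + 1))) [DecidablePred (· ∈ A)]
    (hA : ∀ C : PBond P (k + 1 + 1), C ∉ A → ∀ t < P.L,
      ((line C t).src ≠ c.src ∧ (line C t).src ≠ c.tgt) ∧ ((line C t).tgt ≠ c.src ∧ (line C t).tgt ≠ c.tgt))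
    (hsepB : ∀ C ∈ A, ∀ c' ∈ S',
      ¬ ((line C (P.L - 1)).tgt = c'.src ∨ (line C (P.L - 1)).tgt = c'.tgt) ∧ ¬ ((line C 0).src = c'.src ∨ (line C 0).src = c'.tgt)) :
    ((fieldMeasure P k G).withDensity (fun U => gc U * g' U)).map
        (fun U : GaugeField P k G =>
          ((fun C : ↥Aᶜ => (axialAvg (fun c' : PBond P (k + 1) => if c' ∈ insert c S' then m c' U else axialAvg U c') : GaugeField P (k + 1 + 1) G) C),
           (fun C : ↥A => (axialAvg (fun c' : PBond P (k + 1) => if c' ∈ insert c S' then m c' U else axialAvg U c') : GaugeField P (k + 1 + 1) G) C))) =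
      (∫⁻ U, gc U ∂(fieldMeasure P k G)) •
        ((fieldMeasure P k G).withDensity g').map
          (fun U : GaugeField P k G =>
            ((fun C : ↥Aᶜ => (axialAvg (fun c' : PBond P (k + 1) => if c' ∈ S' then m c' U else axialAvg U c') : GaugeField P (k + 1 + 1) G) C),
             (fun C : ↥A => (axialAvg (fun c' : PBond P (k + 1) => if c' ∈ S' then m c' U else axialAvg U c') : GaugeField P (k + 1 + 1) G) C))) := by
  set Φ₁ : GaugeField P k G → GaugeField P (k + 1 + 1) G :=
    fun U => axialAvg (fun c' : PBond P (k + 1) => if c' ∈ insert c S' then m c' U else axialAvg U c') with hΦ₁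
  set Φ₂ : GaugeField P k G → GaugeField P (k + 1 + 1) G :=
    fun U => axialAvg (fun c' : PBond P (k + 1) => if c' ∈ S' then m c' U else axialAvg U c') with hΦ₂
  have hHyb : ∀ (S : Finset (PBond P (k + 1))), (∀ c' ∈ S, Measurable (m c')) →
      Measurable (fun U : GaugeField P k G => fun c' : PBond P (k + 1) => if c' ∈ S then m c' U else axialAvg U c') := by
    intro S hS
    refine measurable_pi_iff.mpr fun c' => ?_
    by_cases hc : c' ∈ S
    · simp only [hc, if_true]; exact hS c' hc
    · simp only [hc, if_false]; exact (measurable_pi_iff.mp measurable_axialAvg) c'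
  have hm2 : ∀ c' ∈ S', Measurable (m c') := fun c' hc' => hm c' (Finset.mem_insert_of_mem hc')
  have hm_read2 : ∀ c' ∈ S', ∀ U U' : GaugeField P k G,
      (∀ (i : Idx P), ∀ s ∈ walk (emb c'.src) (loopWord P.L c'.dir (off i.1) i.2.1 i.2.2), U s.bond = U' s.bond) → m c' U = m c' U' :=
    fun c' hc' => hm_read c' (Finset.mem_insert_of_mem hc')
  have hΦ₂m : Measurable Φ₂ := measurable_axialAvg.comp (hHyb _ hm2)
  have hprojA : Measurable (fun (V : GaugeField P (k + 1 + 1) G) (C : ↥A) => V C) := measurable_pi_iff.mpr fun C => measurable_pi_apply (C : PBond P (k + 1 + 1))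
  have hprojB : Measurable (fun (V : GaugeField P (k + 1 + 1) G) (C : ↥Aᶜ) => V C) := measurable_pi_iff.mpr fun C => measurable_pi_apply (C : PBond P (k + 1 + 1))
  -- (Step 3) away from `c` the two systems agree pointwise
  have haway : ∀ (U : GaugeField P k G) (C : PBond P (k + 1 + 1)), C ∉ A → Φ₁ U C = Φ₂ U C := by
    intro U C hC
    refine BalabanUVNodesN08GuardReadSet.axialAvg_congr_of_read_line C fun t ht => ?_
    have hne : line C t ≠ c := by
      intro h; have := (hA C hC t ht).1.1; rw [h] at this; exact this rfl
    show (if line C t ∈ insert c S' then m (line C t) U else axialAvg U (line C t)) = (if line C t ∈ S' then m (line C t) U else axialAvg U (line C t))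
    by_cases h2 : line C t ∈ S'
    · rw [if_pos (Finset.mem_insert_of_mem h2), if_pos h2]
    · have hni : line C t ∉ insert c S' := fun h => by
        rcases Finset.mem_insert.mp h with h | h
        exacts [hne h, h2 h]
      rw [if_neg hni, if_neg h2]
  -- the set of near coordinates laundered by RIGHT translations
  set T : Set ↥A := {a | ¬ ((line (a : PBond P (k + 1 + 1)) (P.L - 1)).tgt = c.src ∨ (line (a : PBond P (k + 1 + 1)) (P.L - 1)).tgt = c.tgt)} with hT
  classical
  -- (Steps 1–2) the local Weil core in each system; the translations are shared
  -- extension of a near field `h : ↥A → G` by `1`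
  have hext_def : ∀ (h : ↥A → G) (C : PBond P (k + 1 + 1)) (hC : C ∈ A),
      (fun C' : PBond P (k + 1 + 1) => if hC' : C' ∈ A then h ⟨C', hC'⟩ else (1 : G)) C = h ⟨C, hC⟩ := fun h C hC => by simp [hC]
  have hext_off : ∀ (h : ↥A → G) (C : PBond P (k + 1 + 1)), C ∉ A →
      (fun C' : PBond P (k + 1 + 1) => if hC' : C' ∈ A then h ⟨C', hC'⟩ else (1 : G)) C = 1 := fun h C hC => by simp [hC]
  -- generic launderer: for a firing set `S ⊆ insert c S'` containing the relevant read constraints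
  have hlaunder : ∀ (S : Finset (PBond P (k + 1))) (hSsub : S ⊆ insert c S') (f : GaugeField P k G → ℝ≥0∞) (hf : Measurable f) (hffin : ∫⁻ U, f U ∂(fieldMeasure P k G) ≠ ∞)
      (hf_read : ∀ U U' : GaugeField P k G,
        (∀ c' ∈ insert c S', ∀ (i : Idx P), ∀ s ∈ walk (emb c'.src) (loopWord P.L c'.dir (off i.1) i.2.1 i.2.2), U s.bond = U' s.bond) → f U = f U'),
      ((fieldMeasure P k G).withDensity f).map (fun U =>
          ((fun C : ↥Aᶜ => (axialAvg (fun c' : PBond P (k + 1) => if c' ∈ S then m c' U else axialAvg U c') : GaugeField P (k + 1 + 1) G) C),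
           (fun C : ↥A => (axialAvg (fun c' : PBond P (k + 1) => if c' ∈ S then m c' U else axialAvg U c') : GaugeField P (k + 1 + 1) G) C))) =
        (((fieldMeasure P k G).withDensity f).map (fun U => fun C : ↥Aᶜ =>
            (axialAvg (fun c' : PBond P (k + 1) => if c' ∈ S then m c' U else axialAvg U c') : GaugeField P (k + 1 + 1) G) C)).prod
          (Measure.pi fun _ : ↥A => (HaarData.haar : Measure G)) := by
    intro S hSsub f hf hffin hf_read
    have hmS : ∀ c' ∈ S, Measurable (m c') := fun c' hc' => hm c' (hSsub hc')
    have hm_readS : ∀ c' ∈ S, ∀ U U' : GaugeField P k G,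
        (∀ (i : Idx P), ∀ s ∈ walk (emb c'.src) (loopWord P.L c'.dir (off i.1) i.2.1 i.2.2), U s.bond = U' s.bond) → m c' U = m c' U' :=
      fun c' hc' => hm_read c' (hSsub hc')
    have hΦm : Measurable (fun U : GaugeField P k G => (axialAvg (fun c' : PBond P (k + 1) => if c' ∈ S then m c' U else axialAvg U c') : GaugeField P (k + 1 + 1) G)) :=
      measurable_axialAvg.comp (hHyb _ hmS)
    refine map_prod_eq_prod_pi_of_translations (G := G) (fieldMeasure P k G) T hf hffin (hprojA.comp hΦm) (hprojB.comp hΦm) ?_ ?_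
    · -- RIGHT translations of the near coordinates in `T`
      intro h hh
      set hx : GaugeField P (k + 1 + 1) G := fun C' => if hC' : C' ∈ A then h ⟨C', hC'⟩ else 1 with hhx
      -- `hx C = 1` unless `C ∈ A` with `⟨C⟩ ∈ T`
      have hx1 : ∀ C : PBond P (k + 1 + 1), (∃ c₂ ∈ insert c S', (line C (P.L - 1)).tgt = c₂.src ∨ (line C (P.L - 1)).tgt = c₂.tgt) → hx C = 1 := by
        rintro C ⟨c₂, hc₂, hinc⟩
        by_cases hC : C ∈ A
        · rw [Finset.mem_insert] at hc₂
          rcases hc₂ with rfl | hc₂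
          · have : (⟨C, hC⟩ : ↥A) ∉ T := fun hT' => hT' hinc
            rw [hhx, hext_def h C hC]; exact hh _ this
          · exact absurd hinc (hsepB C hC c₂ hc₂).1
        · rw [hhx]; exact hext_off h C hC
      have hx1S : ∀ C : PBond P (k + 1 + 1), (∃ c₂ ∈ S, (line C (P.L - 1)).tgt = c₂.src ∨ (line C (P.L - 1)).tgt = c₂.tgt) → hx C = 1 :=
        fun C ⟨c₂, hc₂, hinc⟩ => hx1 C ⟨c₂, hSsub hc₂, hinc⟩
      refine ⟨fun U b => U b * Function.extend (fun c₁ : PBond P (k + 1) => line c₁ (P.L - 1))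
          (Function.extend (fun C : PBond P (k + 1 + 1) => line C (P.L - 1)) hx (fun _ => 1)) (fun _ => 1) b, measurePreserving_mulRight _, ?_, ?_, ?_⟩
      · -- `f` fixed
        intro U
        refine hf_read _ _ fun c' hc' i s hs => ?_
        have hh'1 : ∀ c₁ : PBond P (k + 1), (c₁.tgt = c'.src ∨ c₁.tgt = c'.tgt) →
            Function.extend (fun C : PBond P (k + 1 + 1) => line C (P.L - 1)) hx (fun _ => 1) c₁ = 1 := by
          intro c₁ hinc
          by_cases hex : ∃ C : PBond P (k + 1 + 1), line C (P.L - 1) = c₁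
          · obtain ⟨C, rfl⟩ := hex
            rw [(last_injective hk1).extend_apply]; exact hx1 C ⟨c', hc', hinc⟩
          · rw [Function.extend_apply' _ _ _ hex]
        show U s.bond * _ = U s.bond
        rw [extend_last_apply_eq_one_of_read hk c' _ hh'1 i s hs, mul_one]
      · -- away coordinates fixed
        intro U
        funext C
        show axialAvg _ (C : PBond P (k + 1 + 1)) = _
        rw [axialAvg_piecewise_mulLast_eq hk hk1 S hm_readS hx hx1S U]
        show axialAvg _ (C : PBond P (k + 1 + 1)) * hx C = _
        rw [hhx, hext_off h C (show (C : PBond P (k + 1 + 1)) ∉ A from C.2), mul_one]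
      · -- near coordinates right-multiplied by `h`
        intro U
        funext a
        show axialAvg _ (a : PBond P (k + 1 + 1)) = _
        rw [axialAvg_piecewise_mulLast_eq hk hk1 S hm_readS hx hx1S U]
        show axialAvg _ (a : PBond P (k + 1 + 1)) * hx a = _
        rw [hhx, hext_def h a a.2]
        rfl
    · -- LEFT translations of the near coordinates outside `T` (there the FIRST slot's source is off `c`'s endpoints, ✓125′'s torus fact)
      intro h hh
      set hx : GaugeField P (k + 1 + 1) G := fun C' => if hC' : C' ∈ A then h ⟨C', hC'⟩ else 1 with hhx
      have hx1 : ∀ C : PBond P (k + 1 + 1), (∃ c₂ ∈ insert c S', (line C 0).src = c₂.src ∨ (line C 0).src = c₂.tgt) → hx C = 1 := by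
        rintro C ⟨c₂, hc₂, hinc⟩
        by_cases hC : C ∈ A
        · rw [Finset.mem_insert] at hc₂
          rcases hc₂ with rfl | hc₂
          · rw [hhx, hext_def h C hC]
            by_cases hT' : (⟨C, hC⟩ : ↥A) ∈ T
            · exact hh _ hT'
            · exfalso
              have hlast : (line C (P.L - 1)).tgt = c₂.src ∨ (line C (P.L - 1)).tgt = c₂.tgt := by
                by_contra hn; exact hT' hn
              rcases BalabanUVNodesN08TwoLevelInvisibleFiring.last_tgt_or_first_src_off hk1 c₂ C with h1 | h1
              · exact h1 hlast
              · exact h1 hinc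
          · exact absurd hinc (hsepB C hC c₂ hc₂).2
        · rw [hhx]; exact hext_off h C hC
      have hx1S : ∀ C : PBond P (k + 1 + 1), (∃ c₂ ∈ S, (line C 0).src = c₂.src ∨ (line C 0).src = c₂.tgt) → hx C = 1 :=
        fun C ⟨c₂, hc₂, hinc⟩ => hx1 C ⟨c₂, hSsub hc₂, hinc⟩
      refine ⟨fun U b => Function.extend (fun c₁ : PBond P (k + 1) => line c₁ 0)
          (Function.extend (fun C : PBond P (k + 1 + 1) => line C 0) hx (fun _ => 1)) (fun _ => 1) b * U b, measurePreserving_mulLeft _, ?_, ?_, ?_⟩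
      · intro U
        refine hf_read _ _ fun c' hc' i s hs => ?_
        have hh'1 : ∀ c₁ : PBond P (k + 1), (c₁.src = c'.src ∨ c₁.src = c'.tgt) →
            Function.extend (fun C : PBond P (k + 1 + 1) => line C 0) hx (fun _ => 1) c₁ = 1 := by
          intro c₁ hinc
          by_cases hex : ∃ C : PBond P (k + 1 + 1), line C 0 = c₁
          · obtain ⟨C, rfl⟩ := hex
            rw [(first_injective hk1).extend_apply]; exact hx1 C ⟨c', hc', hinc⟩
          · rw [Function.extend_apply' _ _ _ hex]
        show _ * U s.bond = U s.bond
        rw [extend_first_apply_eq_one_of_read hk c' _ hh'1 i s hs, one_mul]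
      · intro U
        funext C
        show axialAvg _ (C : PBond P (k + 1 + 1)) = _
        rw [axialAvg_piecewise_mulFirst_eq hk hk1 S hm_readS hx hx1S U]
        show hx C * axialAvg _ (C : PBond P (k + 1 + 1)) = _
        rw [hhx, hext_off h C (show (C : PBond P (k + 1 + 1)) ∉ A from C.2), one_mul]
      · intro U
        funext a
        show axialAvg _ (a : PBond P (k + 1 + 1)) = _
        rw [axialAvg_piecewise_mulFirst_eq hk hk1 S hm_readS hx hx1S U]
        show hx a * axialAvg _ (a : PBond P (k + 1 + 1)) = _
        rw [hhx, hext_def h a a.2]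
        rfl
  -- read hypotheses in the form the launderer wants
  have hread1 : ∀ U U' : GaugeField P k G,
      (∀ c' ∈ insert c S', ∀ (i : Idx P), ∀ s ∈ walk (emb c'.src) (loopWord P.L c'.dir (off i.1) i.2.1 i.2.2), U s.bond = U' s.bond) → gc U * g' U = gc U' * g' U' := by
    intro U U' hUU'
    rw [hgc_read U U' (hUU' c (Finset.mem_insert_self c S')), hg'_read U U' fun c' hc' => hUU' c' (Finset.mem_insert_of_mem hc')]
  have hread2 : ∀ U U' : GaugeField P k G,
      (∀ c' ∈ insert c S', ∀ (i : Idx P), ∀ s ∈ walk (emb c'.src) (loopWord P.L c'.dir (off i.1) i.2.1 i.2.2), U s.bond = U' s.bond) → g' U = g' U' :=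
    fun U U' hUU' => hg'_read U U' fun c' hc' => hUU' c' (Finset.mem_insert_of_mem hc')
  have step1 := hlaunder (insert c S') (subset_refl _) (fun U => gc U * g' U) (hgc.mul hg') hfin1 hread1
  have step2 := hlaunder S' (Finset.subset_insert c S') g' hg' hfin2 hread2
  -- (Step 4) the away-marginal: system 1 = (∫ g_c) • system 2, by read-set Fubini over the read set of `c`
  set Rc : Set (PBond P k) := {b | ∃ (i : Idx P), ∃ s ∈ walk (emb c.src) (loopWord P.L c.dir (off i.1) i.2.1 i.2.2), s.bond = b} with hRc
  have hgcS : ∀ U U' : GaugeField P k G, (∀ b ∈ Rc, U b = U' b) → gc U = gc U' :=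
    fun U U' hUU' => hgc_read U U' fun i s hs => hUU' _ ⟨i, s, hs, rfl⟩
  -- a bond read by a bond NOT incident to `c`'s endpoints is outside `Rc`
  have hfar : ∀ c' : PBond P (k + 1), (c'.src ≠ c.src ∧ c'.src ≠ c.tgt) ∧ (c'.tgt ≠ c.src ∧ c'.tgt ≠ c.tgt) →
      ∀ (i : Idx P), ∀ s ∈ walk (emb c'.src) (loopWord P.L c'.dir (off i.1) i.2.1 i.2.2), s.bond ∉ Rc := by
    intro c' hc' i s hs hmem
    obtain ⟨i₀, s₀, hs₀, hb⟩ := hmem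
    have hblk := blockOf_src_of_mem_walk hk c' i s hs
    refine BalabanUVNodesN08GuardReadSet.ne_of_blockOf_src_ne hk c (b := s.bond) ?_ ?_ i₀ s₀ hs₀ hb
    · rcases hblk with h | h
      · rw [h]; exact hc'.1.1
      · rw [h]; exact hc'.2.1
    · rcases hblk with h | h
      · rw [h]; exact hc'.1.2
      · rw [h]; exact hc'.2.2
  have hg'S : ∀ U U' : GaugeField P k G, (∀ b ∉ Rc, U b = U' b) → g' U = g' U' :=
    fun U U' hUU' => hg'_read U U' fun c' hc' i s hs => hUU' _ (hfar c' (hsepA c' hc') i s hs)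
  have hawayS : ∀ U U' : GaugeField P k G, (∀ b ∉ Rc, U b = U' b) →
      (fun C : ↥Aᶜ => Φ₂ U C) = fun C : ↥Aᶜ => Φ₂ U' C := by
    intro U U' hUU'
    funext C
    have hC : (C : PBond P (k + 1 + 1)) ∉ A := C.2
    refine BalabanUVNodesN08GuardReadSet.axialAvg_congr_of_read_line (C : PBond P (k + 1 + 1)) fun t ht => ?_
    have hni := hA C hC t ht
    show (if line C t ∈ S' then m (line C t) U else axialAvg U (line C t)) = (if line C t ∈ S' then m (line C t) U' else axialAvg U' (line C t))
    by_cases h2 : line (C : PBond P (k + 1 + 1)) t ∈ S'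
    · rw [if_pos h2, if_pos h2]
      exact hm_read2 _ h2 U U' fun i s hs => hUU' _ (hfar _ hni i s hs)
    · rw [if_neg h2, if_neg h2]
      refine BalabanUVNodesN08GuardReadSet.axialAvg_congr_of_read_line _ fun t' ht' => hUU' _ ?_
      exact fun hmem => by
        obtain ⟨i₀, s₀, hs₀, hb⟩ := hmem
        exact BalabanUVNodesN08GuardReadSetIncidence.segment_unread_of_not_incident hk c _ hni.1 hni.2 ht' i₀ s₀ hs₀ hb
  have step4 : ((fieldMeasure P k G).withDensity (fun U => gc U * g' U)).map (fun U => fun C : ↥Aᶜ => Φ₁ U C) =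
      (∫⁻ U, gc U ∂(fieldMeasure P k G)) • ((fieldMeasure P k G).withDensity g').map (fun U => fun C : ↥Aᶜ => Φ₂ U C) := by
    have hfun : (fun U => fun C : ↥Aᶜ => Φ₁ U C) = fun U => fun C : ↥Aᶜ => Φ₂ U C := by
      funext U; funext C; exact haway U C C.2
    rw [hfun]
    exact map_withDensity_mul_eq_smul_of_readSets Rc hgc hgcS hg' hg'S (hprojB.comp hΦ₂m) hawayS
  -- (Step 5) assemble
  show ((fieldMeasure P k G).withDensity (fun U => gc U * g' U)).map (fun U => ((fun C : ↥Aᶜ => Φ₁ U C), (fun C : ↥A => Φ₁ U C))) =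
    (∫⁻ U, gc U ∂(fieldMeasure P k G)) • ((fieldMeasure P k G).withDensity g').map (fun U => ((fun C : ↥Aᶜ => Φ₂ U C), (fun C : ↥A => Φ₂ U C)))
  rw [step1, step2, step4, Measure.prod_smul_left]

end Delete

end Summit.QuantumFields.YangMills.Theorems.BalabanUVNodesN08DeleteFiring

end
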